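import Literature.NumberTheory.LFunctions.WeilFirstPrimeCertificate
import HarnessLib

/-!
# First-prime Weil certificate: the analytic steps from abstract cell facts, generic `q`

Topic: `Literature/NumberTheory/LFunctions`. Two generalisations of the soundness chain of
`WeilFirstPrimeCertificate.lean` (first-prime Weil positivity by the moment method of
H. Yoshida, Adv. Stud. Pure Math. 21 (1992), §6), needed to run the certificate with SHARP
constants (`WeilFirstPrimeCertificateSharp.lean`) and with ANY cell checker:

* `CellsFacts wL T cells` — the five analytic facts about the signed minorant
  `γ = cellsGamma₂ wL cells` that the certificate consumes: the level bound `wL − γ ≤ w₂`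
  (`w₂(t) = Re ψ(1/4 + it/2) − √2 log 2 cos(t log 2)`), vanishing beyond `T`, even moments
  `= 2·cellsMomentQ₂`, `|γ|`-moments `≤ 2·cellsAbsMomentQ`, and the sup bound `≤ cellsBndSumQ`.
  `cellsFacts_of_checkCells₂` derives them from the rational checker `checkCells₂`; a faster
  (integer) cell checker only has to prove the same five facts to drive the whole certificate.
* Step B (`WeilCert2.arch_lower_bound_of_facts`) and Step C
  (`WeilCert2.freq_integral_bound_of_facts`) of the reduction, from `CellsFacts` (the proofs are
  those of the `checkCells₂` versions, verbatim).
* The exact matrix `P = Sym − q·Ĝ` for an ARBITRARY rational `q` (`WeilCert.pmQWith`), realised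
  through the existing block machinery — which hard-codes the six-digit `invTwoPiHi` — by
  rescaling the moment table: `pmQ (nuScaled q ν) = pmQWith q ν` (`WeilCert.pmQ_nuScaled`), and
  its real form `WeilCert2.pmQWith_cast`. So `checkBlockK (nuScaled q ν) κ p` checks the parity
  blocks of `Dᵀ rd(Sym − q·Ĝ) D + κ(…)` with no new block code.

The checker with `q, q_lo, ℓ` as parameters, its soundness and the twenty-digit instantiation
are in `WeilFirstPrimeCertificateSharp.lean`. Everything here is proved; no named facts.

## References

* H. Yoshida, *On Hermitian forms attached to zeta functions*, Adv. Stud. Pure Math. 21 (1992),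
  §2 (2.1), §6, Theorem 1 (p. 310).
-/

noncomputable section

open Complex Finset MeasureTheory Set Filter
open scoped Real Topology ComplexConjugate BigOperators

namespace Literature.NumberTheory.LFunctions

/-! ## The analytic facts about a certified first-prime minorant -/

/-- The analytic content of a certified first-prime minorant `σ = wL − γ`,
`γ = cellsGamma₂ wL cells`, exactly as consumed by the moment-method certificate: the minorant
property `wL − γ(t) ≤ w₂(t)`, `γ(t) = 0` for `|t| ≥ T`, the even moments
`∫ γ t^q = 2·cellsMomentQ₂(q)`, the `|γ|`-moments `∫ |γ| t^q ≤ 2·cellsAbsMomentQ(q)` (even `q`),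
and the sup bound `|γ| ≤ Σ_j bnd_j`. [folklore] -/
structure CellsFacts (wL T : ℚ) (cells : List FPDCell) : Prop where
  /-- the minorant property `wL − γ(t) ≤ w₂(t) = Re ψ(1/4 + it/2) − √2 log 2 cos(t log 2)` -/
  level_le : ∀ t : ℝ, (wL : ℝ) - cellsGamma₂ wL cells t ≤
    Literature.Analysis.SpecialFunctions.reDigammaQuarter t -
      Real.sqrt 2 * Real.log 2 * Real.cos (t * Real.log 2)
  /-- `γ(t) = 0` for `|t| ≥ T` -/
  eq_zero : ∀ ⦃t : ℝ⦄, (T : ℝ) ≤ |t| → cellsGamma₂ wL cells t = 0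
  /-- even moments: integrability and `∫ γ(t) t^q dt = 2·cellsMomentQ₂(q)` -/
  moment : ∀ ⦃q : ℕ⦄, Even q → Integrable (fun t ↦ cellsGamma₂ wL cells t * t ^ q) ∧
    ∫ t, cellsGamma₂ wL cells t * t ^ q = 2 * (cellsMomentQ₂ wL cells q : ℝ)
  /-- `|γ|`-moments: integrability and `∫ |γ(t)| t^q dt ≤ 2·cellsAbsMomentQ(q)` for even `q` -/
  absMoment : ∀ ⦃q : ℕ⦄, Even q → Integrable (fun t ↦ |cellsGamma₂ wL cells t| * t ^ q) ∧
    ∫ t, |cellsGamma₂ wL cells t| * t ^ q ≤ 2 * (cellsAbsMomentQ wL cells q : ℝ)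
  /-- the sup bound `|γ(t)| ≤ Σ_j bnd_j` -/
  abs_le : ∀ t : ℝ, |cellsGamma₂ wL cells t| ≤ (cellsBndSumQ wL cells : ℝ)

/-- The rational cell checker `checkCells₂` establishes the five facts. [folklore] -/
theorem cellsFacts_of_checkCells₂ {p : ℕ} {wL T : ℚ} {mwT : ℕ} {cells : List FPDCell}
    (h : checkCells₂ p wL T mwT cells = true) : CellsFacts wL T cells where
  level_le := level_sub_cellsGamma₂_le h
  eq_zero _ ht := cellsGamma₂_eq_zero h ht
  moment _ hq := integral_cellsGamma₂_mul_pow h hq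
  absMoment _ hq := integral_abs_cellsGamma₂_mul_pow_le h hq
  abs_le := abs_cellsGamma₂_le_bndSum h

namespace CellsFacts

variable {wL T : ℚ} {cells : List FPDCell}

/-- `0 ≤ Σ_j bnd_j`. [folklore] -/
theorem bndSum_nonneg (hF : CellsFacts wL T cells) : (0 : ℝ) ≤ (cellsBndSumQ wL cells : ℝ) :=
  (abs_nonneg _).trans (hF.abs_le 0)

/-- `0 ≤ cellsAbsMomentQ(q)` for even `q`. [folklore] -/
theorem absMomentQ_nonneg (hF : CellsFacts wL T cells) {q : ℕ} (hq : Even q) :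
    (0 : ℝ) ≤ (cellsAbsMomentQ wL cells q : ℝ) := by
  have h := (hF.absMoment hq).2
  have h0 : 0 ≤ ∫ t, |cellsGamma₂ wL cells t| * t ^ q :=
    integral_nonneg fun t ↦ mul_nonneg (abs_nonneg _) (by rw [← hq.pow_abs]; positivity)
  linarith

/-- All moments of `γ`: `∫ γ(t) t^q dt = 2·cellsMomentQ₂(q)` for even `q` and `= 0` for odd `q`
(`γ` is even), with integrability. [folklore] -/
theorem integral_gamma_pow (hF : CellsFacts wL T cells) (q : ℕ) :
    Integrable (fun t ↦ cellsGamma₂ wL cells t * t ^ q) ∧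
      ∫ t, cellsGamma₂ wL cells t * t ^ q =
        if Even q then 2 * (cellsMomentQ₂ wL cells q : ℝ) else 0 := by
  rcases Nat.even_or_odd q with hq | hq
  · rw [if_pos hq]; exact hF.moment hq
  · rw [if_neg (Nat.not_even_iff_odd.2 hq)]
    have h0 := (hF.absMoment Even.zero).1
    have h1 := (hF.absMoment hq.add_one).1
    simp only [pow_zero, mul_one] at h0
    set γ := cellsGamma₂ wL cells with hγ
    have hint : Integrable (fun t ↦ γ t * t ^ q) := by
      refine Integrable.mono' (h0.add h1)
        (((measurable_cellsGamma₂ _ _).mul (measurable_id.pow_const q)).aestronglyMeasurable)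
        (Eventually.of_forall fun t ↦ ?_)
      rw [Real.norm_eq_abs, abs_mul]
      simp only [Pi.add_apply]
      rw [show |γ t| + |γ t| * t ^ (q + 1) = |γ t| * (1 + t ^ (q + 1)) by ring]
      refine mul_le_mul_of_nonneg_left ?_ (abs_nonneg _)
      rw [abs_pow]
      rcases le_or_gt |t| 1 with ht | ht
      · have : |t| ^ q ≤ 1 := pow_le_one₀ (abs_nonneg t) ht
        have : 0 ≤ t ^ (q + 1) := by rw [← (hq.add_one).pow_abs]; positivity
        linarith
      · have : |t| ^ q ≤ |t| ^ (q + 1) := pow_le_pow_right₀ ht.le (Nat.le_succ q)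
        rw [(hq.add_one).pow_abs] at this
        linarith
    refine ⟨hint, ?_⟩
    have hodd : ∀ t, γ (-t) * (-t) ^ q = -(γ t * t ^ q) := by
      intro t; rw [hγ, WeilCert2.cellsGamma₂_neg, hq.neg_pow]; ring
    have h := integral_neg_eq_self (fun t ↦ γ t * t ^ q) volume
    simp_rw [hodd] at h
    rw [integral_neg] at h
    linarith

end CellsFacts

/-! ## The exact matrix `P = Sym − q Ĝ` for an arbitrary rational `q` -/

/-- `invTwoPiHi ≠ 0`. [folklore] -/
theorem invTwoPiHi_ne_zero : invTwoPiHi ≠ 0 := by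
  unfold invTwoPiHi piLo; norm_num

namespace WeilCert

variable (c : WeilCert)

/-- The moment table rescaled by `q / invTwoPiHi` (length `2N + 1`): feeding it to the block
machinery of `WeilCert` (whose `pmQ` hard-codes the six-digit `invTwoPiHi`) realises the matrix
`Sym − q Ĝ(ν)` for an arbitrary rational `q` (`pmQ_nuScaled`). [folklore] -/
def nuScaled (q : ℚ) (nu : List ℚ) : List ℚ :=
  tabV (2 * c.N + 1) fun i ↦ q / invTwoPiHi * getV nu i

/-- The exact matrix `P = Sym − q Ĝ` of the reduced quadratic form with an arbitrary rational
`q` in place of `invTwoPiHi`: `Sym_{kl} = 2(−1)^k τ(k)τ(l)`,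
`Ĝ_{kl} = (−1)^k (−1)^{(k+l)/2} ν_{k+l}/(k! l!)`, zero across parities. [folklore] -/
def pmQWith (q : ℚ) (nu : List ℚ) (k l : ℕ) : ℚ :=
  if k % 2 = l % 2 then
    (-1 : ℚ) ^ k * 2 * c.tauQ k * c.tauQ l -
      q * ((-1 : ℚ) ^ k * (-1 : ℚ) ^ ((k + l) / 2) * getV nu (k + l) / (k.factorial * l.factorial))
  else 0

variable {c}

/-- Entries of the rescaled table. [folklore] -/
theorem getV_nuScaled (q : ℚ) (nu : List ℚ) {i : ℕ} (hi : i < 2 * c.N + 1) :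
    getV (c.nuScaled q nu) i = q / invTwoPiHi * getV nu i := by
  unfold nuScaled; rw [getV_tabV _ hi]

/-- **`pmQ` re-instantiated:** on the rescaled table the hard-coded matrix is `Sym − q Ĝ(ν)`,
for all indices `k, l ≤ N`. [folklore] -/
theorem pmQ_nuScaled (q : ℚ) (nu : List ℚ) {k l : ℕ} (hk : k < c.N + 1) (hl : l < c.N + 1) :
    c.pmQ (c.nuScaled q nu) k l = c.pmQWith q nu k l := by
  unfold pmQ pmQWith
  by_cases hkl : k % 2 = l % 2
  · rw [if_pos hkl, if_pos hkl, getV_nuScaled q nu (by omega)]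
    have h := invTwoPiHi_ne_zero
    have e1 : invTwoPiHi * (q / invTwoPiHi) = q := by field_simp
    rw [show invTwoPiHi * ((-1 : ℚ) ^ k * (-1 : ℚ) ^ ((k + l) / 2) * (q / invTwoPiHi * getV nu (k + l)) /
        (k.factorial * l.factorial)) =
        (invTwoPiHi * (q / invTwoPiHi)) * ((-1 : ℚ) ^ k * (-1 : ℚ) ^ ((k + l) / 2) * getV nu (k + l) /
          (k.factorial * l.factorial)) by ring, e1]
  · rw [if_neg hkl, if_neg hkl]

/-- `pmQWith` is symmetric. [folklore] -/
theorem pmQWith_symm (q : ℚ) (nu : List ℚ) (k l : ℕ) : c.pmQWith q nu k l = c.pmQWith q nu l k := by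
  unfold pmQWith
  by_cases hkl : k % 2 = l % 2
  · rw [if_pos hkl, if_pos hkl.symm]
    have hs : (-1 : ℚ) ^ k = (-1) ^ l := by
      rw [neg_one_pow_eq_pow_mod_two (R := ℚ) (n := k), neg_one_pow_eq_pow_mod_two (R := ℚ) (n := l), hkl]
    rw [hs, Nat.add_comm l k]
    ring
  · rw [if_neg hkl, if_neg (fun h ↦ hkl h.symm)]

end WeilCert

namespace WeilCert2

variable {c : WeilCert2}

/-- **Entry identity for an arbitrary `q`:** `(pmQ (nuScaled q ν) k l : ℝ) = Sym_{kl} − q Ĝ_{kl}`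
for `k, l ≤ N`, with `Ĝ = WeilCert2.gHat` (the moments `ν_q` of the first-prime minorant). [folklore] -/
theorem pmQWith_cast (hnu : c.checkNu = true) (q : ℚ) {k l : ℕ} (hk : k < c.base.N + 1)
    (hl : l < c.base.N + 1) :
    ((c.base.pmQ (c.base.nuScaled q c.nuTab) k l : ℚ) : ℝ) =
      (if k % 2 = l % 2 then
        (-1 : ℝ) ^ k * 2 * (((c.base.a0 : ℝ) / 2) ^ k / k.factorial) *
          (((c.base.a0 : ℝ) / 2) ^ l / l.factorial)
        else 0) -
      ((q : ℚ) : ℝ) * gHat c k l := by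
  rw [WeilCert.pmQ_nuScaled q c.nuTab hk hl]
  unfold WeilCert.pmQWith gHat
  by_cases hkl : k % 2 = l % 2
  · rw [if_pos hkl, if_pos hkl, if_pos hkl, getV_nuTab hnu (by omega) (by omega)]
    push_cast
    rw [WeilCert.tauQ_cast, WeilCert.tauQ_cast]
  · rw [if_neg hkl, if_neg hkl, if_neg hkl]
    simp

/-! ## Step C from the facts: the frequency side -/

variable {g : ℝ → ℂ}

/-- **Frequency bound (signed minorant), from the cell facts.**
`∫ ‖ĝ(1/2+it)‖² γ(t) dt ≤ Σ Ĝ_{kl} Re(conj M_k M_l) + 5 ‖g‖₁² ν'_abs`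
for `tsupport g ⊆ [-a₀, a₀]`, `0 < a₀`, `2a₀T ≤ N + 2`, `2(a₀T)^{N+1}/(N+1)! ≤ 1`, `N + 1` even. [folklore] -/
theorem freq_integral_bound_of_facts (hF : CellsFacts c.base.wL c.base.T c.cells)
    (ha0 : 0 < c.base.a0) (haT : 2 * c.base.a0 * c.base.T ≤ (c.base.N : ℚ) + 2)
    (hρT : 2 * (c.base.a0 * c.base.T) ^ (c.base.N + 1) / (c.base.N + 1).factorial ≤ 1)
    (hN : c.base.N + 1 = 2 * c.base.nb) (hg : IsWeilTest g)
    (hsupp : tsupport g ⊆ Icc (-(c.base.a0 : ℝ)) c.base.a0) :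
    ∫ t : ℝ, ‖weilMellin g (1 / 2 + t * I)‖ ^ 2 * cellsGamma₂ c.base.wL c.cells t ≤
      ∑ k ∈ range (c.base.N + 1), ∑ l ∈ range (c.base.N + 1),
          gHat c k l * (conj (weilMoment c.base.a0 g k) * weilMoment c.base.a0 g l).re +
        5 * weilNorm1 g ^ 2 * ((c.nuPrimeAbs : ℚ) : ℝ) := by
  set a : ℝ := (c.base.a0 : ℝ) with ha_def
  have ha : 0 < a := by rw [ha_def]; exact_mod_cast ha0
  set γ : ℝ → ℝ := cellsGamma₂ c.base.wL c.cells with hγ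
  set M : ℕ → ℂ := weilMoment a g with hM
  set n := c.base.N + 1 with hn
  set L := weilNorm1 g with hL
  have hn_even : Even n := ⟨c.base.nb, by omega⟩
  -- the pointwise bound (signed): S·γ + R·|γ|
  set W : ℕ → ℕ → ℝ := fun k l ↦
    (((-1 : ℂ) ^ k * I ^ (k + l)) * (conj (M k) * M l)).re with hW
  have hpt : ∀ t : ℝ, ‖weilMellin g (1 / 2 + t * I)‖ ^ 2 * γ t ≤
      (∑ k ∈ range n, ∑ l ∈ range n,
        W k l * (a ^ (k + l) / (k.factorial * l.factorial)) * (γ t * t ^ (k + l))) +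
        5 * L ^ 2 * (2 * a ^ n / n.factorial) * (|γ t| * t ^ n) := by
    intro t
    rcases lt_or_ge |t| (c.base.T : ℝ) with ht | ht
    · have ht1 : 2 * a * |t| ≤ c.base.N + 2 := by
        have h1 : 2 * a * |t| ≤ 2 * a * c.base.T := by nlinarith
        have h2 : (2 * c.base.a0 * c.base.T : ℝ) ≤ c.base.N + 2 := by exact_mod_cast haT
        rw [ha_def] at h1 ⊢; linarith
      have ht2 : 2 * (|t| * a) ^ (c.base.N + 1) / (c.base.N + 1).factorial ≤ 1 := by
        have h1 : (|t| * a) ^ (c.base.N + 1) ≤ (c.base.T * a) ^ (c.base.N + 1) :=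
          pow_le_pow_left₀ (by positivity) (by nlinarith) _
        have h2 : (2 * (c.base.a0 * c.base.T) ^ (c.base.N + 1) / (c.base.N + 1).factorial : ℝ) ≤ 1 := by
          exact_mod_cast hρT
        rw [ha_def] at h1 ⊢
        rw [mul_comm (c.base.a0 : ℝ)] at h2
        have h3 : 2 * (|t| * ↑c.base.a0) ^ (c.base.N + 1) / ((c.base.N + 1).factorial : ℝ) ≤
            2 * (↑c.base.T * ↑c.base.a0) ^ (c.base.N + 1) / ((c.base.N + 1).factorial : ℝ) := by
          gcongr
        linarith
      have h := freq_pointwise_bound_abs hg ha hsupp c.base.N ht1 ht2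
      set S : ℝ := ∑ k ∈ range (c.base.N + 1), ∑ l ∈ range (c.base.N + 1),
          (((-1 : ℂ) ^ k * I ^ (k + l)) * (conj (M k) * M l)).re *
            ((t * a) ^ (k + l) / (k.factorial * l.factorial)) with hS
      set R : ℝ := 5 * (2 * (|t| * a) ^ (c.base.N + 1) / (c.base.N + 1).factorial) * L ^ 2 with hR
      have hR0 : 0 ≤ R := by rw [hR]; positivity
      have hdiff : |‖weilMellin g (1 / 2 + t * I)‖ ^ 2 - S| ≤ R := by rw [hS, hR, hM]; exact h
      -- `φ γ = S γ + (φ − S) γ ≤ S γ + R |γ|`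
      have hkey : ‖weilMellin g (1 / 2 + t * I)‖ ^ 2 * γ t ≤ S * γ t + R * |γ t| := by
        have e : ‖weilMellin g (1 / 2 + t * I)‖ ^ 2 * γ t =
            S * γ t + (‖weilMellin g (1 / 2 + t * I)‖ ^ 2 - S) * γ t := by ring
        rw [e]
        have := abs_mul (‖weilMellin g (1 / 2 + t * I)‖ ^ 2 - S) (γ t)
        have h2 : |‖weilMellin g (1 / 2 + t * I)‖ ^ 2 - S| * |γ t| ≤ R * |γ t| :=
          mul_le_mul_of_nonneg_right hdiff (abs_nonneg _)
        linarith [le_abs_self ((‖weilMellin g (1 / 2 + t * I)‖ ^ 2 - S) * γ t)]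
      refine hkey.trans (le_of_eq ?_)
      congr 1
      · rw [hS, Finset.sum_mul, ← hn]
        refine Finset.sum_congr rfl fun k _ ↦ ?_
        rw [Finset.sum_mul]
        refine Finset.sum_congr rfl fun l _ ↦ ?_
        rw [hW, mul_pow]
        simp only
        ring
      · rw [hR, ← hn_even.pow_abs t, hn, mul_pow]
        ring
    · have h0 : γ t = 0 := hF.eq_zero ht
      rw [h0]
      simp
  -- integrability of all terms
  obtain ⟨B, hB0, hB⟩ := exists_abs_cellsGamma₂_le c.base.wL c.cells
  have hiL : Integrable fun t : ℝ ↦ ‖weilMellin g (1 / 2 + t * I)‖ ^ 2 * γ t :=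
    integrable_norm_sq_weilMellin_mul hg (measurable_cellsGamma₂ _ _) hB0 le_rfl (B := 0)
      (fun t ↦ by simpa using hB t)
  have hiq : ∀ q, Integrable fun t ↦ γ t * t ^ q := fun q ↦ (hF.integral_gamma_pow q).1
  obtain ⟨hiabs, habsle⟩ := hF.absMoment hn_even
  have hiR : Integrable fun t ↦ (∑ k ∈ range n, ∑ l ∈ range n,
      W k l * (a ^ (k + l) / (k.factorial * l.factorial)) * (γ t * t ^ (k + l))) +
      5 * L ^ 2 * (2 * a ^ n / n.factorial) * (|γ t| * t ^ n) := by
    refine Integrable.add (integrable_finsetSum _ fun k _ ↦ integrable_finsetSum _ fun l _ ↦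
      (hiq (k + l)).const_mul _) (hiabs.const_mul _)
  have hint := integral_mono hiL hiR hpt
  refine hint.trans ?_
  rw [integral_add (integrable_finsetSum _ fun k _ ↦ integrable_finsetSum _ fun l _ ↦
      (hiq (k + l)).const_mul _) (hiabs.const_mul _),
    integral_finsetSum _ fun k _ ↦ integrable_finsetSum _ fun l _ ↦ (hiq (k + l)).const_mul _]
  refine add_le_add (le_of_eq ?_) ?_
  · refine Finset.sum_congr rfl fun k _ ↦ ?_
    rw [integral_finsetSum _ fun l _ ↦ (hiq (k + l)).const_mul _]
    refine Finset.sum_congr rfl fun l _ ↦ ?_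
    rw [integral_const_mul, (hF.integral_gamma_pow (k + l)).2, gHat]
    by_cases hkl : k % 2 = l % 2
    · have hev : Even (k + l) := (WeilCert.mod_two_eq_iff_even k l).1 hkl
      rw [if_pos hkl, if_pos hev, hW]
      simp only
      rw [WeilAna.I_pow_even hev,
        show ((-1 : ℂ) ^ k * (-1) ^ ((k + l) / 2)) * (conj (M k) * M l) =
          (((-1 : ℝ) ^ k * (-1) ^ ((k + l) / 2) : ℝ) : ℂ) * (conj (M k) * M l) by push_cast; ring,
        Complex.re_ofReal_mul]
      unfold nuQ
      push_cast
      rw [hM, ha_def]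
      ring
    · have hodd : ¬ Even (k + l) := fun h ↦ hkl ((WeilCert.mod_two_eq_iff_even k l).2 h)
      rw [if_neg hkl, if_neg hodd]
      simp
  · rw [integral_const_mul]
    have hfac : 0 ≤ 5 * L ^ 2 * (2 * a ^ n / n.factorial) := by positivity
    have := mul_le_mul_of_nonneg_left habsle hfac
    refine this.trans (le_of_eq ?_)
    unfold nuPrimeAbs
    push_cast
    rw [hn, ha_def]
    ring

/-! ## Step B from the facts: the minorant -/

/-- **Minorant bound, from the cell facts.**
`wL · 2π ‖g‖₂² − ∫ ‖ĝ‖² γ ≤ ∫ ‖ĝ(1/2+it)‖² w₂(t) dt` with the first-prime weight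
`w₂(t) = Re ψ(1/4 + it/2) − √2 log 2 cos(t log 2)`. [folklore] -/
theorem arch_lower_bound_of_facts (hF : CellsFacts c.base.wL c.base.T c.cells) (hg : IsWeilTest g) :
    (c.base.wL : ℝ) * (2 * π * weilNorm2Sq g) -
        ∫ t : ℝ, ‖weilMellin g (1 / 2 + t * I)‖ ^ 2 * cellsGamma₂ c.base.wL c.cells t ≤
      ∫ t : ℝ, ‖weilMellin g (1 / 2 + t * I)‖ ^ 2 *
        (Literature.Analysis.SpecialFunctions.reDigammaQuarter t -
          Real.sqrt 2 * Real.log 2 * Real.cos (t * Real.log 2)) := by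
  obtain ⟨B, hB0, hB⟩ := exists_abs_cellsGamma₂_le c.base.wL c.cells
  set σ : ℝ → ℝ := fun t ↦ (c.base.wL : ℝ) - cellsGamma₂ c.base.wL c.cells t with hσ
  have hσm : Measurable σ := measurable_const.sub (measurable_cellsGamma₂ _ _)
  have hσb : ∀ t, |σ t| ≤ (|(c.base.wL : ℝ)| + B) + 0 * t ^ 2 := fun t ↦ by
    rw [hσ, zero_mul, add_zero]
    exact (abs_sub _ _).trans (add_le_add le_rfl (hB t))
  have hle : ∀ t, σ t ≤ Literature.Analysis.SpecialFunctions.reDigammaQuarter t -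
      Real.sqrt 2 * Real.log 2 * Real.cos (t * Real.log 2) := fun t ↦ hF.level_le t
  have hi1 : Integrable fun t : ℝ ↦ ‖weilMellin g (1 / 2 + t * I)‖ ^ 2 * σ t :=
    integrable_norm_sq_weilMellin_mul hg hσm (by positivity) le_rfl hσb
  have hi2a := integrable_norm_sq_weilMellin_mul_reDigammaQuarter hg
  have hi2b : Integrable fun t : ℝ ↦
      ‖weilMellin g (1 / 2 + t * I)‖ ^ 2 * (Real.sqrt 2 * Real.log 2 * Real.cos (t * Real.log 2)) :=
    integrable_norm_sq_weilMellin_mul hg (by fun_prop) (A := Real.sqrt 2 * Real.log 2) (B := 0)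
      (by positivity) le_rfl fun t ↦ by
        rw [zero_mul, add_zero, abs_mul, abs_of_nonneg (by positivity : (0 : ℝ) ≤ Real.sqrt 2 * Real.log 2)]
        exact mul_le_of_le_one_right (by positivity) (Real.abs_cos_le_one _)
  have hi2 : Integrable fun t : ℝ ↦ ‖weilMellin g (1 / 2 + t * I)‖ ^ 2 *
      (Literature.Analysis.SpecialFunctions.reDigammaQuarter t -
        Real.sqrt 2 * Real.log 2 * Real.cos (t * Real.log 2)) := by
    have e : (fun t : ℝ ↦ ‖weilMellin g (1 / 2 + t * I)‖ ^ 2 *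
        (Literature.Analysis.SpecialFunctions.reDigammaQuarter t -
          Real.sqrt 2 * Real.log 2 * Real.cos (t * Real.log 2))) =
        fun t : ℝ ↦ ‖weilMellin g (1 / 2 + t * I)‖ ^ 2 * Literature.Analysis.SpecialFunctions.reDigammaQuarter t -
          ‖weilMellin g (1 / 2 + t * I)‖ ^ 2 * (Real.sqrt 2 * Real.log 2 * Real.cos (t * Real.log 2)) := by
      funext t; ring
    rw [e]; exact hi2a.sub hi2b
  have h := integral_mono hi1 hi2 fun t ↦ mul_le_mul_of_nonneg_left (hle t) (sq_nonneg _)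
  refine le_trans (le_of_eq ?_) h
  have hj1 := integrable_norm_sq_weilMellin_half_line hg
  have hj2 : Integrable fun t : ℝ ↦ ‖weilMellin g (1 / 2 + t * I)‖ ^ 2 * cellsGamma₂ c.base.wL c.cells t :=
    integrable_norm_sq_weilMellin_mul hg (measurable_cellsGamma₂ _ _) hB0 le_rfl (B := 0)
      (fun t ↦ by simpa using hB t)
  have e : (fun t : ℝ ↦ ‖weilMellin g (1 / 2 + t * I)‖ ^ 2 * σ t) = fun t : ℝ ↦
      (c.base.wL : ℝ) * ‖weilMellin g (1 / 2 + t * I)‖ ^ 2 -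
        ‖weilMellin g (1 / 2 + t * I)‖ ^ 2 * cellsGamma₂ c.base.wL c.cells t := by
    funext t; rw [hσ]; ring
  rw [e, integral_sub (hj1.const_mul _) hj2, integral_const_mul,
    integral_norm_sq_weilMellin_half_line hg]

end WeilCert2

end Literature.NumberTheory.LFunctions
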